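import Literature.AlgebraicGeometry.ModuliOfAbelianVarieties.SiegelModuliInterpretation
import Literature.AlgebraicGeometry.ModuliOfAbelianVarieties.SiegelPrincipalLevelNormal
import Literature.NumberTheory.Adeles.FiniteAdeleLatticeOfGLLevel
import HarnessLib

/-!
# The adelic congruence `b·v̂ ≡ b′·ŵ (mod ℤ̂^{2g})` as a correspondence of rational torsion: kernel, totality,
# uniqueness modulo the lattices, exactness on `N`-torsion levels

Topic `Literature/AlgebraicGeometry/ModuliOfAbelianVarieties`; namespace `Literature.AlgebraicGeometry.ModuliOfAbelianVarieties`
(that of ★ T1′ `SiegelModuliInterpretation`).  THEOREMS ONLY (no definition, no named fact, no instance, no `sorry`) over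
the carriers ★ T1′ `AdelicCongr b b′ v w` («every coordinate of `b v̂ − b′ ŵ` is an integral finite adèle», the relation
«`η(v)` and `η′(w)` name the same torsion point» of [Milne2005ShimuraVarieties] §6 p. 75 «`V/Λ ≅ V(𝔸_f)/Λ̂`») and ★ R60-19
`Adeles.latticeOfGL a = Λ_a = ℚⁿ ∩ a ℤ̂ⁿ`.

For `b, b′ ∈ GL_{2g}(𝔸_{ℚ,f})` the relation `R_{b,b′}(v, w) :⇔ AdelicCongr b b′ v w` between `v, w ∈ V = ℚ^{2g}` is the graph,
on the dense rational torsion, of the isomorphism `V/Λ_{b⁻¹} ⥲ V(𝔸_f)/b⁻¹ℤ̂^{2g} ⥲ V(𝔸_f)/b′⁻¹ℤ̂^{2g} ⥲ V/Λ_{b′⁻¹}`,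
`v ↦ b′⁻¹ b v`.  Proved here, pointwise (the form consumers `obtain`):

* §1 `R_{b,b′}` is an additive correspondence: `AdelicCongr.zero/add/neg/sub/nsmul/zsmul`, `adelicCongr_comm`
  (`R_{b,b′}(v,w) ↔ R_{b′,b}(w,v)`), `AdelicCongr.trans` (`R_{b,b′} ∘ R_{b′,b″} ⊆ R_{b,b″}`), `AdelicCongr.mul_left`
  (`R_{b,b′} ⊆ R_{ub,ub′}` for integral `u`);
* §1 KERNELS and UNIQUENESS: `adelicCongr_zero_right_iff` (`R(v, 0) ↔ v ∈ Λ_{b⁻¹}`), `adelicCongr_zero_left_iff`,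
  `AdelicCongr.sub_mem_latticeOfGL_right/left` (two partners of the same vector differ by a lattice vector),
  `AdelicCongr.of_sub_mem_latticeOfGL_right/left` and the `↔` forms — i.e. `R` descends to an INJECTIVE map
  `V/Λ_{b⁻¹} → V/Λ_{b′⁻¹}` with injective transpose;
* §2 TOTALITY `exists_adelicCongr_right/left` (every `v` has a partner `w` and conversely; weak approximation
  `𝔸_{ℚ,f} = ℚ + N ℤ̂`, ★ `Adeles.exists_rat_add_natCast_mul`) — so the induced map is a BIJECTION `V/Λ_{b⁻¹} ≃ V/Λ_{b′⁻¹}`;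
* §3 LEVELS `AdelicCongr.nsmul_mem_latticeOfGL_iff` (`N v ∈ Λ_{b⁻¹} ↔ N w ∈ Λ_{b′⁻¹}`): the bijection is exact on the
  `N`-torsion `N⁻¹Λ/Λ` for every `N` — «level-`N` structures correspond exactly»;
* §4 THE CONSUMER SHAPE of ★ T1′ `SiegelRationalModel.IsModuli` (`b = k a⁻¹`, `b′ = a′⁻¹`, `k ∈ K_δ(1) = GSp_δ(ℤ̂)`):
  `latticeOfGL_inv_coe_mul_inv_eq` (`Λ_{(k a⁻¹)⁻¹} = Λ_a`), `latticeOfGL_inv_coe_inv_eq` (`Λ_{(a′⁻¹)⁻¹} = Λ_{a′}`), hence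
  `mem_latticeOfGL_iff_of_adelicCongr`, `nsmul_mem_latticeOfGL_iff_of_adelicCongr`, and in marking currency
  `SiegelAdelicMarking.r_eq_r_iff_of_adelicCongr` — for markings `m` of `A` at `[J, a]` and `m′` of `A′` at `[J′, a′]`,
  `R`-partners satisfy `u(v₁) = u(v₂) ↔ u′(w₁) = u′(w₂)`: the correspondence descends to a BIJECTION `u(V) → u′(V)` of the
  rational torsion (★ T1′ `r_eq_r_iff_sub_mem_latticeOfGL`), and `SiegelAdelicMarking.exists_r_partner_right/left`.

This is the adelic engine of [Milne2005ShimuraVarieties] Thm. 6.11 / §14 «`f` is an isomorphism of the level structures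
`σ ∘ η_a K → η_{a′} K`» (cell hodgecm-mathlib, M1PRIME-DAG ANNEX B §2 rows I1-i «torsion-bijective» and I1-iii «level-`N`
structures correspond exactly»; road #60, crux item of `HDel`).  CM-free and reciprocity-free; banked generic leaf (books 0).
The `k = 1` special cases `adelicCongr_right_sub`-style bookkeeping of the route-ξ′ assembly (B-p09) are instances of §1.
HC_CM is proved only modulo the 7 printed citations until rung 0 closes.

## References
* [Milne2005ShimuraVarieties] J. S. Milne, *Introduction to Shimura varieties* (2005; 2017 revision), §4 pp. 48–49
  (lattices and `𝔸_f`), §6 Thm. 6.11 p. 74 and p. 75 («`V/Λ ≅ V(𝔸_f)/Λ̂`»), §14 Prop. 14.12 p. 125 (hypothesis).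
* [Deligne1971TravauxShimura] P. Deligne, *Travaux de Shimura* (1971), 4.16 p. 150, proof of Thm. 4.21 (a)–(c) p. 152.
* [CasselsFrohlichANT1967] J. W. S. Cassels, A. Fröhlich (eds.), *Algebraic Number Theory* (1967), Ch. II §15 (`𝔸_f = ℚ + N ℤ̂`).
-/

set_option autoImplicit false

noncomputable section

open Matrix NumberField IsDedekindDomain
open Literature.NumberTheory.Adeles (latticeOfGL mem_latticeOfGL_iff latticeOfGL_mul_eq_of_mem exists_nat_mul_entries_mem
  mem_integralAdeles_iff_mem_integralFiniteAdeles exists_rat_add_natCast_mul)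
open Literature.NumberTheory.Automorphic (integralFiniteAdeles)

namespace Literature.AlgebraicGeometry.ModuliOfAbelianVarieties

open Literature.AlgebraicGeometry.Motives (AbelianVariety)

variable {g : ℕ} {δ : Fin g → ℕ}

/-! ### §0. `adelicVec` bookkeeping (additivity of the diagonal embedding `V → V ⊗ 𝔸_f`) -/

section AdelicVec

/-- `adelicVec v` is the coordinatewise diagonal embedding `algebraMap ℚ 𝔸_{ℚ,f} ∘ v` (definitional).
[cite: Milne2005ShimuraVarieties, §4 pp. 48–49] -/
theorem adelicVec_eq_comp (v : Fin g ⊕ Fin g → ℚ) : adelicVec v = ⇑(algebraMap ℚ finAdeleQ) ∘ v := rfl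

/-- `adelicVec 0 = 0`. [cite: Milne2005ShimuraVarieties, §4 pp. 48–49] -/
theorem adelicVec_zero : adelicVec (0 : Fin g ⊕ Fin g → ℚ) = 0 := by
  funext i; simp [adelicVec_apply]

/-- `adelicVec` is additive. [cite: Milne2005ShimuraVarieties, §4 pp. 48–49] -/
theorem adelicVec_add (v w : Fin g ⊕ Fin g → ℚ) : adelicVec (v + w) = adelicVec v + adelicVec w := by
  funext i; simp [adelicVec_apply]

/-- `adelicVec` commutes with negation. [cite: Milne2005ShimuraVarieties, §4 pp. 48–49] -/
theorem adelicVec_neg (v : Fin g ⊕ Fin g → ℚ) : adelicVec (-v) = -adelicVec v := by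
  funext i; simp [adelicVec_apply]

/-- `adelicVec (N • v) = N • adelicVec v` for `N : ℕ`. [cite: Milne2005ShimuraVarieties, §4 pp. 48–49] -/
theorem adelicVec_nsmul (N : ℕ) (v : Fin g ⊕ Fin g → ℚ) : adelicVec (N • v) = N • adelicVec v := by
  funext i; simp [adelicVec_apply]

end AdelicVec

/-! ### §1. `AdelicCongr b b′` is an additive correspondence; kernels and uniqueness modulo the lattices -/

section Algebra

variable {b b' b'' : GL (Fin g ⊕ Fin g) finAdeleQ} {v v' w w' x : Fin g ⊕ Fin g → ℚ}

/-- Integral matrices send integral vectors to integral vectors (`𝓞̂`-spelling). [folklore] -/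
private theorem mulVec_apply_mem_integralAdeles' {M : Matrix (Fin g ⊕ Fin g) (Fin g ⊕ Fin g) finAdeleQ}
    (hM : ∀ i j, M i j ∈ FiniteAdeleRing.integralAdeles (𝓞 ℚ) ℚ) {y : Fin g ⊕ Fin g → finAdeleQ}
    (hy : ∀ j, y j ∈ FiniteAdeleRing.integralAdeles (𝓞 ℚ) ℚ) (i : Fin g ⊕ Fin g) :
    (M *ᵥ y) i ∈ FiniteAdeleRing.integralAdeles (𝓞 ℚ) ℚ := by
  rw [Matrix.mulVec, dotProduct]; exact sum_mem fun j _ => mul_mem (hM i j) (hy j)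

variable (b b') in
/-- `R_{b,b′}(0, 0)`. [cite: Milne2005ShimuraVarieties, §6 Thm. 6.11 p. 74 and p. 75] -/
theorem AdelicCongr.zero : AdelicCongr b b' (0 : Fin g ⊕ Fin g → ℚ) 0 := by
  intro i
  rw [adelicVec_zero, Matrix.mulVec_zero, Matrix.mulVec_zero, sub_zero, Pi.zero_apply]
  exact zero_mem _

/-- `R_{b,b′}` is closed under addition. [cite: Milne2005ShimuraVarieties, §6 Thm. 6.11 p. 74 and p. 75] -/
theorem AdelicCongr.add (h : AdelicCongr b b' v w) (h' : AdelicCongr b b' v' w') :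
    AdelicCongr b b' (v + v') (w + w') := by
  intro i
  have e : ((b : Matrix (Fin g ⊕ Fin g) (Fin g ⊕ Fin g) finAdeleQ) *ᵥ adelicVec (v + v') -
        (b' : Matrix (Fin g ⊕ Fin g) (Fin g ⊕ Fin g) finAdeleQ) *ᵥ adelicVec (w + w')) i =
      ((b : Matrix (Fin g ⊕ Fin g) (Fin g ⊕ Fin g) finAdeleQ) *ᵥ adelicVec v -
          (b' : Matrix (Fin g ⊕ Fin g) (Fin g ⊕ Fin g) finAdeleQ) *ᵥ adelicVec w) i +
        ((b : Matrix (Fin g ⊕ Fin g) (Fin g ⊕ Fin g) finAdeleQ) *ᵥ adelicVec v' -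
          (b' : Matrix (Fin g ⊕ Fin g) (Fin g ⊕ Fin g) finAdeleQ) *ᵥ adelicVec w') i := by
    rw [adelicVec_add, adelicVec_add, Matrix.mulVec_add, Matrix.mulVec_add]
    simp only [Pi.sub_apply, Pi.add_apply]
    ring
  rw [e]
  exact add_mem (h i) (h' i)

/-- `R_{b,b′}` is closed under negation. [cite: Milne2005ShimuraVarieties, §6 Thm. 6.11 p. 74 and p. 75] -/
theorem AdelicCongr.neg (h : AdelicCongr b b' v w) : AdelicCongr b b' (-v) (-w) := by
  intro i
  have e : ((b : Matrix (Fin g ⊕ Fin g) (Fin g ⊕ Fin g) finAdeleQ) *ᵥ adelicVec (-v) -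
        (b' : Matrix (Fin g ⊕ Fin g) (Fin g ⊕ Fin g) finAdeleQ) *ᵥ adelicVec (-w)) i =
      -(((b : Matrix (Fin g ⊕ Fin g) (Fin g ⊕ Fin g) finAdeleQ) *ᵥ adelicVec v -
          (b' : Matrix (Fin g ⊕ Fin g) (Fin g ⊕ Fin g) finAdeleQ) *ᵥ adelicVec w) i) := by
    rw [adelicVec_neg, adelicVec_neg, Matrix.mulVec_neg, Matrix.mulVec_neg]
    simp only [Pi.sub_apply, Pi.neg_apply]
    ring
  rw [e]
  exact neg_mem (h i)

/-- `R_{b,b′}` is closed under subtraction. [cite: Milne2005ShimuraVarieties, §6 Thm. 6.11 p. 74 and p. 75] -/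
theorem AdelicCongr.sub (h : AdelicCongr b b' v w) (h' : AdelicCongr b b' v' w') :
    AdelicCongr b b' (v - v') (w - w') := by
  rw [sub_eq_add_neg, sub_eq_add_neg]; exact h.add h'.neg

/-- `R_{b,b′}` is closed under `ℕ`-multiples. [cite: Milne2005ShimuraVarieties, §6 Thm. 6.11 p. 74 and p. 75] -/
theorem AdelicCongr.nsmul (h : AdelicCongr b b' v w) (N : ℕ) : AdelicCongr b b' (N • v) (N • w) := by
  induction N with
  | zero => rw [zero_smul, zero_smul]; exact AdelicCongr.zero b b'
  | succ N ih => rw [succ_nsmul, succ_nsmul]; exact ih.add h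

/-- `R_{b,b′}` is closed under `ℤ`-multiples. [cite: Milne2005ShimuraVarieties, §6 Thm. 6.11 p. 74 and p. 75] -/
theorem AdelicCongr.zsmul (h : AdelicCongr b b' v w) (z : ℤ) : AdelicCongr b b' (z • v) (z • w) := by
  obtain ⟨N, rfl | rfl⟩ := Int.eq_nat_or_neg z
  · rw [natCast_zsmul, natCast_zsmul]; exact h.nsmul N
  · rw [neg_smul, neg_smul, natCast_zsmul, natCast_zsmul]; exact (h.nsmul N).neg

/-- **Symmetry**: `R_{b,b′}(v, w) ↔ R_{b′,b}(w, v)` (`b v̂ − b′ ŵ = −(b′ ŵ − b v̂)`).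
[cite: Milne2005ShimuraVarieties, §6 Thm. 6.11 p. 74 and p. 75] -/
theorem adelicCongr_comm : AdelicCongr b b' v w ↔ AdelicCongr b' b w v := by
  refine forall_congr' fun i => ?_
  rw [← neg_mem_iff, Pi.sub_apply, Pi.sub_apply, neg_sub]

/-- **Transitivity / composition**: `R_{b,b′}(v, w)` and `R_{b′,b″}(w, x)` give `R_{b,b″}(v, x)`
(`(b v̂ − b′ ŵ) + (b′ ŵ − b″ x̂) = b v̂ − b″ x̂`). [cite: Milne2005ShimuraVarieties, §6 Thm. 6.11 p. 74 and p. 75] -/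
theorem AdelicCongr.trans (h₁ : AdelicCongr b b' v w) (h₂ : AdelicCongr b' b'' w x) : AdelicCongr b b'' v x := by
  intro i
  have e : ((b : Matrix (Fin g ⊕ Fin g) (Fin g ⊕ Fin g) finAdeleQ) *ᵥ adelicVec v -
        (b'' : Matrix (Fin g ⊕ Fin g) (Fin g ⊕ Fin g) finAdeleQ) *ᵥ adelicVec x) i =
      ((b : Matrix (Fin g ⊕ Fin g) (Fin g ⊕ Fin g) finAdeleQ) *ᵥ adelicVec v -
          (b' : Matrix (Fin g ⊕ Fin g) (Fin g ⊕ Fin g) finAdeleQ) *ᵥ adelicVec w) i +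
        ((b' : Matrix (Fin g ⊕ Fin g) (Fin g ⊕ Fin g) finAdeleQ) *ᵥ adelicVec w -
          (b'' : Matrix (Fin g ⊕ Fin g) (Fin g ⊕ Fin g) finAdeleQ) *ᵥ adelicVec x) i := by
    simp only [Pi.sub_apply]; ring
  rw [e]
  exact add_mem (h₁ i) (h₂ i)

/-- **Integral change of coordinates on the adelic side**: an integral matrix `u` (e.g. `u ∈ GL_{2g}(ℤ̂)`) preserves the
relation, `R_{b,b′}(v, w) → R_{ub,ub′}(v, w)`. [cite: Milne2005ShimuraVarieties, §4 pp. 48–49] -/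
theorem AdelicCongr.mul_left {u : GL (Fin g ⊕ Fin g) finAdeleQ}
    (hu : ∀ i j, (u : Matrix (Fin g ⊕ Fin g) (Fin g ⊕ Fin g) finAdeleQ) i j ∈ FiniteAdeleRing.integralAdeles (𝓞 ℚ) ℚ)
    (h : AdelicCongr b b' v w) : AdelicCongr (u * b) (u * b') v w := by
  intro i
  rw [Units.val_mul, Units.val_mul, ← Matrix.mulVec_mulVec, ← Matrix.mulVec_mulVec, ← Matrix.mulVec_sub]
  exact mulVec_apply_mem_integralAdeles' hu h i

/-- **KERNEL on the right**: `R_{b,b′}(v, 0) ↔ v ∈ Λ_{b⁻¹}` (`b v̂ ∈ ℤ̂^{2g}` iff `v ∈ ℚ^{2g} ∩ b⁻¹ℤ̂^{2g}`; ★ R60-19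
`mem_latticeOfGL_iff`). [cite: Milne2005ShimuraVarieties, §4 pp. 48–49 and §6 p. 75] -/
theorem adelicCongr_zero_right_iff : AdelicCongr b b' v 0 ↔ v ∈ latticeOfGL b⁻¹ := by
  rw [mem_latticeOfGL_iff, inv_inv, ← adelicVec_eq_comp]
  refine forall_congr' fun i => ?_
  rw [adelicVec_zero, Matrix.mulVec_zero, sub_zero, mem_integralAdeles_iff_mem_integralFiniteAdeles]

/-- **KERNEL on the left**: `R_{b,b′}(0, w) ↔ w ∈ Λ_{b′⁻¹}`. [cite: Milne2005ShimuraVarieties, §4 pp. 48–49 and §6 p. 75] -/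
theorem adelicCongr_zero_left_iff : AdelicCongr b b' 0 w ↔ w ∈ latticeOfGL b'⁻¹ := by
  rw [adelicCongr_comm, adelicCongr_zero_right_iff]

/-- **UNIQUENESS on the right modulo `Λ_{b′⁻¹}`**: two partners `w, w′` of the same `v` differ by a lattice vector,
`w′ − w ∈ Λ_{b′⁻¹}`. [cite: Milne2005ShimuraVarieties, §6 Thm. 6.11 p. 74 and p. 75] -/
theorem AdelicCongr.sub_mem_latticeOfGL_right (h : AdelicCongr b b' v w) (h' : AdelicCongr b b' v w') :
    w' - w ∈ latticeOfGL b'⁻¹ := by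
  rw [← adelicCongr_zero_left_iff (b := b)]
  have hs := h'.sub h
  rwa [sub_self] at hs

/-- **UNIQUENESS on the left modulo `Λ_{b⁻¹}`**: two partners `v, v′` of the same `w` differ by a lattice vector,
`v′ − v ∈ Λ_{b⁻¹}`. [cite: Milne2005ShimuraVarieties, §6 Thm. 6.11 p. 74 and p. 75] -/
theorem AdelicCongr.sub_mem_latticeOfGL_left (h : AdelicCongr b b' v w) (h' : AdelicCongr b b' v' w) :
    v' - v ∈ latticeOfGL b⁻¹ := by
  rw [← adelicCongr_zero_right_iff (b' := b')]
  have hs := h'.sub h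
  rwa [sub_self] at hs

/-- Changing the right partner by a lattice vector of `Λ_{b′⁻¹}` preserves the relation.
[cite: Milne2005ShimuraVarieties, §6 Thm. 6.11 p. 74 and p. 75] -/
theorem AdelicCongr.of_sub_mem_latticeOfGL_right (h : AdelicCongr b b' v w) (hw : w' - w ∈ latticeOfGL b'⁻¹) :
    AdelicCongr b b' v w' := by
  have h0 : AdelicCongr b b' 0 (w' - w) := adelicCongr_zero_left_iff.2 hw
  have e1 : v = v + 0 := (add_zero v).symm
  have e2 : w' = w + (w' - w) := by abel
  rw [e1, e2]
  exact h.add h0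

/-- Changing the left partner by a lattice vector of `Λ_{b⁻¹}` preserves the relation.
[cite: Milne2005ShimuraVarieties, §6 Thm. 6.11 p. 74 and p. 75] -/
theorem AdelicCongr.of_sub_mem_latticeOfGL_left (h : AdelicCongr b b' v w) (hv : v' - v ∈ latticeOfGL b⁻¹) :
    AdelicCongr b b' v' w := by
  have h0 : AdelicCongr b b' (v' - v) 0 := adelicCongr_zero_right_iff.2 hv
  have e1 : v' = v + (v' - v) := by abel
  have e2 : w = w + 0 := (add_zero w).symm
  rw [e1, e2]
  exact h.add h0

/-- **The right fibre of `v` is exactly a `Λ_{b′⁻¹}`-coset**: given one partner `w`, `R_{b,b′}(v, w′) ↔ w′ − w ∈ Λ_{b′⁻¹}`.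
[cite: Milne2005ShimuraVarieties, §6 Thm. 6.11 p. 74 and p. 75] -/
theorem AdelicCongr.right_iff (h : AdelicCongr b b' v w) : AdelicCongr b b' v w' ↔ w' - w ∈ latticeOfGL b'⁻¹ :=
  ⟨h.sub_mem_latticeOfGL_right, h.of_sub_mem_latticeOfGL_right⟩

/-- **The left fibre of `w` is exactly a `Λ_{b⁻¹}`-coset**: given one partner `v`, `R_{b,b′}(v′, w) ↔ v′ − v ∈ Λ_{b⁻¹}`.
[cite: Milne2005ShimuraVarieties, §6 Thm. 6.11 p. 74 and p. 75] -/
theorem AdelicCongr.left_iff (h : AdelicCongr b b' v w) : AdelicCongr b b' v' w ↔ v' - v ∈ latticeOfGL b⁻¹ :=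
  ⟨h.sub_mem_latticeOfGL_left, h.of_sub_mem_latticeOfGL_left⟩

/-- **Well-defined and injective modulo the lattices**: for two related pairs, `v₁ − v₂ ∈ Λ_{b⁻¹} ↔ w₁ − w₂ ∈ Λ_{b′⁻¹}` —
`R_{b,b′}` descends to an INJECTIVE map `V/Λ_{b⁻¹} → V/Λ_{b′⁻¹}`. [cite: Milne2005ShimuraVarieties, §6 Thm. 6.11 p. 74 and p. 75] -/
theorem AdelicCongr.sub_mem_latticeOfGL_iff (h₁ : AdelicCongr b b' v w) (h₂ : AdelicCongr b b' v' w') :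
    v - v' ∈ latticeOfGL b⁻¹ ↔ w - w' ∈ latticeOfGL b'⁻¹ := by
  have hs := h₁.sub h₂
  constructor
  · intro hv
    have h0 : AdelicCongr b b' (v - v') 0 := adelicCongr_zero_right_iff.2 hv
    have := h0.sub_mem_latticeOfGL_right hs
    rwa [sub_zero] at this
  · intro hw
    have h0 : AdelicCongr b b' 0 (w - w') := adelicCongr_zero_left_iff.2 hw
    have := h0.sub_mem_latticeOfGL_left hs
    rwa [sub_zero] at this

end Algebra

/-! ### §2. Totality: every `v` has a partner (weak approximation `𝔸_{ℚ,f} = ℚ + N ℤ̂`) -/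

section Totality

variable (b b' : GL (Fin g ⊕ Fin g) finAdeleQ)

/-- **TOTALITY on the right**: for every `v ∈ V` there is `w ∈ V` with `b v̂ ≡ b′ ŵ (mod ℤ̂^{2g})` — write
`b′⁻¹ b v̂ = k̂ + N y` with `k` rational, `y` integral and `N b′` integral (★ `Adeles.exists_rat_add_natCast_mul`,
★ `Adeles.exists_nat_mul_entries_mem`); then `w := k` works, `b v̂ − b′ k̂ = (N b′) y`.  With §1 the relation is the graph of
a BIJECTION `V/Λ_{b⁻¹} ≃ V/Λ_{b′⁻¹}`. [cite: Milne2005ShimuraVarieties, §6 Thm. 6.11 p. 74 and p. 75 («V/Λ ≅ V(𝔸_f)/Λ̂»)]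
[cite: CasselsFrohlichANT1967, Ch. II §15] -/
theorem exists_adelicCongr_right (v : Fin g ⊕ Fin g → ℚ) : ∃ w : Fin g ⊕ Fin g → ℚ, AdelicCongr b b' v w := by
  obtain ⟨N, hN, hNb', -⟩ := exists_nat_mul_entries_mem b'
  set z : Fin g ⊕ Fin g → finAdeleQ :=
    ((b'⁻¹ : GL (Fin g ⊕ Fin g) finAdeleQ) : Matrix (Fin g ⊕ Fin g) (Fin g ⊕ Fin g) finAdeleQ) *ᵥ
      ((b : Matrix (Fin g ⊕ Fin g) (Fin g ⊕ Fin g) finAdeleQ) *ᵥ adelicVec v) with hz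
  choose k y hy hzk using fun l => exists_rat_add_natCast_mul N hN (z l)
  refine ⟨k, fun i => ?_⟩
  -- `adelicVec k = z - N • y`
  have hk : adelicVec k = z - fun l => (N : finAdeleQ) * y l := by
    funext l
    rw [Pi.sub_apply, adelicVec_apply, eq_sub_iff_add_eq]
    exact (hzk l).symm
  -- `b′ z = b v̂`
  have hb'z : (b' : Matrix (Fin g ⊕ Fin g) (Fin g ⊕ Fin g) finAdeleQ) *ᵥ z =
      (b : Matrix (Fin g ⊕ Fin g) (Fin g ⊕ Fin g) finAdeleQ) *ᵥ adelicVec v := by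
    rw [hz, Matrix.mulVec_mulVec, ← Units.val_mul, mul_inv_cancel, Units.val_one, Matrix.one_mulVec]
  have e : ((b : Matrix (Fin g ⊕ Fin g) (Fin g ⊕ Fin g) finAdeleQ) *ᵥ adelicVec v -
        (b' : Matrix (Fin g ⊕ Fin g) (Fin g ⊕ Fin g) finAdeleQ) *ᵥ adelicVec k) i =
      ((b' : Matrix (Fin g ⊕ Fin g) (Fin g ⊕ Fin g) finAdeleQ) *ᵥ fun l => (N : finAdeleQ) * y l) i := by
    rw [hk, Matrix.mulVec_sub, hb'z, Pi.sub_apply, Pi.sub_apply, sub_sub_cancel]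
  rw [e, Matrix.mulVec, dotProduct]
  refine sum_mem fun l _ => ?_
  rw [← mul_assoc, mul_comm ((b' : Matrix (Fin g ⊕ Fin g) (Fin g ⊕ Fin g) finAdeleQ) i l) (N : finAdeleQ)]
  rw [mem_integralAdeles_iff_mem_integralFiniteAdeles]
  exact mul_mem (hNb' i l) (hy l)

/-- **TOTALITY on the left**: for every `w ∈ V` there is `v ∈ V` with `b v̂ ≡ b′ ŵ (mod ℤ̂^{2g})`.
[cite: Milne2005ShimuraVarieties, §6 Thm. 6.11 p. 74 and p. 75] [cite: CasselsFrohlichANT1967, Ch. II §15] -/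
theorem exists_adelicCongr_left (w : Fin g ⊕ Fin g → ℚ) : ∃ v : Fin g ⊕ Fin g → ℚ, AdelicCongr b b' v w := by
  obtain ⟨v, hv⟩ := exists_adelicCongr_right b' b w
  exact ⟨v, adelicCongr_comm.1 hv⟩

end Totality

/-! ### §3. Levels: the correspondence is exact on `N`-torsion -/

section Levels

variable {b b' : GL (Fin g ⊕ Fin g) finAdeleQ} {v w : Fin g ⊕ Fin g → ℚ}

/-- **EXACTNESS ON `N`-TORSION**: for `R_{b,b′}`-partners `v, w` and every `N`, `N v ∈ Λ_{b⁻¹} ↔ N w ∈ Λ_{b′⁻¹}` — the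
bijection `V/Λ_{b⁻¹} ≃ V/Λ_{b′⁻¹}` restricts to `N⁻¹Λ_{b⁻¹}/Λ_{b⁻¹} ≃ N⁻¹Λ_{b′⁻¹}/Λ_{b′⁻¹}` («level-`N` structures correspond
exactly»). [cite: Milne2005ShimuraVarieties, §6 Thm. 6.11 p. 74 and p. 75] [cite: Deligne1971TravauxShimura, 4.16 p. 150] -/
theorem AdelicCongr.nsmul_mem_latticeOfGL_iff (h : AdelicCongr b b' v w) (N : ℕ) :
    N • v ∈ latticeOfGL b⁻¹ ↔ N • w ∈ latticeOfGL b'⁻¹ := by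
  have := (h.nsmul N).sub_mem_latticeOfGL_iff (AdelicCongr.zero b b')
  rwa [sub_zero, sub_zero] at this

/-- The case `N = 1`: `v ∈ Λ_{b⁻¹} ↔ w ∈ Λ_{b′⁻¹}` (partners vanish together in the tori).
[cite: Milne2005ShimuraVarieties, §6 Thm. 6.11 p. 74 and p. 75] -/
theorem AdelicCongr.mem_latticeOfGL_iff (h : AdelicCongr b b' v w) : v ∈ latticeOfGL b⁻¹ ↔ w ∈ latticeOfGL b'⁻¹ := by
  simpa only [one_smul] using h.nsmul_mem_latticeOfGL_iff 1

/-- `ℤ`-multiple form: `z v ∈ Λ_{b⁻¹} ↔ z w ∈ Λ_{b′⁻¹}`. [cite: Milne2005ShimuraVarieties, §6 Thm. 6.11 p. 74 and p. 75] -/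
theorem AdelicCongr.zsmul_mem_latticeOfGL_iff (h : AdelicCongr b b' v w) (z : ℤ) :
    z • v ∈ latticeOfGL b⁻¹ ↔ z • w ∈ latticeOfGL b'⁻¹ := by
  have := (h.zsmul z).sub_mem_latticeOfGL_iff (AdelicCongr.zero b b')
  rwa [sub_zero, sub_zero] at this

end Levels

/-! ### §3b. The principal level `K_δ(N)` acts trivially on `N`-torsion -/

section LevelN

variable {a k : gspFinAdelic δ} {b' : GL (Fin g ⊕ Fin g) finAdeleQ} {v w : Fin g ⊕ Fin g → ℚ}

/-- **`k ∈ K_δ(N)` acts trivially on `N⁻¹Λ_a`**: if `k ≡ 1 (mod N)` and `N v ∈ Λ_a` then `k a⁻¹ v̂ ≡ a⁻¹ v̂ (mod ℤ̂^{2g})`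
(`(k − 1)·(a⁻¹ v̂) = (N⁻¹(k − 1))·(N a⁻¹ v̂)`, both factors integral) — so on `N`-torsion the relations `R_{k a⁻¹, b′}` and
`R_{a⁻¹, b′}` coincide: «level-`N` structures correspond EXACTLY», independently of the representative `k` of the class
`K_δ(N)`. [cite: Milne2005ShimuraVarieties, §6 Thm. 6.11 p. 74 and p. 75] [cite: Deligne1971TravauxShimura, 4.16 p. 150] -/
theorem adelicCongr_coe_mul_inv_iff_of_mem_principalLevelSubgroup {N : ℕ} (hk : k ∈ principalLevelSubgroup δ N)
    (hv : N • v ∈ latticeOfGL (a : GL (Fin g ⊕ Fin g) finAdeleQ)) :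
    AdelicCongr ((k * a⁻¹ : gspFinAdelic δ) : GL (Fin g ⊕ Fin g) finAdeleQ) b' v w ↔
      AdelicCongr ((a⁻¹ : gspFinAdelic δ) : GL (Fin g ⊕ Fin g) finAdeleQ) b' v w := by
  -- `y := a⁻¹ v̂` has `N y` integral
  set y : Fin g ⊕ Fin g → finAdeleQ :=
    (((a⁻¹ : gspFinAdelic δ) : GL (Fin g ⊕ Fin g) finAdeleQ) : Matrix (Fin g ⊕ Fin g) (Fin g ⊕ Fin g) finAdeleQ) *ᵥ
      adelicVec v with hy
  have hNy : ∀ j, (N : finAdeleQ) * y j ∈ FiniteAdeleRing.integralAdeles (𝓞 ℚ) ℚ := by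
    intro j
    have hj := (mem_latticeOfGL_iff.1 hv) j
    rw [← mem_integralAdeles_iff_mem_integralFiniteAdeles, ← adelicVec_eq_comp, adelicVec_nsmul, Matrix.mulVec_smul,
      Pi.smul_apply, nsmul_eq_mul] at hj
    rw [hy]
    exact hj
  -- the two defects differ by `(k - 1) y`, which is integral
  have hdiff : ∀ i, ((((k : GL (Fin g ⊕ Fin g) finAdeleQ) : Matrix (Fin g ⊕ Fin g) (Fin g ⊕ Fin g) finAdeleQ) - 1) *ᵥ y) i ∈
      FiniteAdeleRing.integralAdeles (𝓞 ℚ) ℚ := by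
    intro i
    rw [Matrix.mulVec, dotProduct]
    refine sum_mem fun j _ => ?_
    obtain ⟨c, hc, hcN⟩ := mem_levelIdeal_iff.1 (hk.1 i j)
    rw [← hcN, mul_comm (N : finAdeleQ) c, mul_assoc]
    exact mul_mem hc (hNy j)
  have hsplit : ((k * a⁻¹ : gspFinAdelic δ) : GL (Fin g ⊕ Fin g) finAdeleQ) =
      (k : GL (Fin g ⊕ Fin g) finAdeleQ) * ((a⁻¹ : gspFinAdelic δ) : GL (Fin g ⊕ Fin g) finAdeleQ) := Subgroup.coe_mul _ _ _
  refine forall_congr' fun i => ?_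
  have e : ((((k * a⁻¹ : gspFinAdelic δ) : GL (Fin g ⊕ Fin g) finAdeleQ) : Matrix (Fin g ⊕ Fin g) (Fin g ⊕ Fin g) finAdeleQ) *ᵥ
          adelicVec v - (b' : Matrix (Fin g ⊕ Fin g) (Fin g ⊕ Fin g) finAdeleQ) *ᵥ adelicVec w) i =
      ((((k : GL (Fin g ⊕ Fin g) finAdeleQ) : Matrix (Fin g ⊕ Fin g) (Fin g ⊕ Fin g) finAdeleQ) - 1) *ᵥ y) i +
        ((((a⁻¹ : gspFinAdelic δ) : GL (Fin g ⊕ Fin g) finAdeleQ) : Matrix (Fin g ⊕ Fin g) (Fin g ⊕ Fin g) finAdeleQ) *ᵥ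
            adelicVec v - (b' : Matrix (Fin g ⊕ Fin g) (Fin g ⊕ Fin g) finAdeleQ) *ᵥ adelicVec w) i := by
    rw [hsplit, Units.val_mul, ← Matrix.mulVec_mulVec, ← hy, Matrix.sub_mulVec, Matrix.one_mulVec]
    simp only [Pi.sub_apply]
    ring
  rw [e]
  exact ⟨fun h => by simpa using sub_mem h (hdiff i), fun h => add_mem (hdiff i) h⟩

end LevelN

/-! ### §4. The consumer shape of `IsModuli`: `b = k a⁻¹`, `b′ = a′⁻¹`, `k ∈ K_δ(1) = GSp_δ(ℤ̂)` -/

section GSp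

variable {J J' : C0pm δ} {a a' k : gspFinAdelic δ} {A A' : AbelianVariety ℂ}

/-- `K_δ(1) ≤ GL_{2g}(ℤ̂)`: an element of the principal level `1` has integral entries and integral inverse (★
`isIntegral_of_isCongOne_one`), in the `GL_n(𝒪̂)`-subgroup currency of ★ R60-19. [cite: Deligne1971TravauxShimura, 4.16 p. 150] -/
theorem coe_mem_units_matrix_integralFiniteAdeles_of_mem_principalLevelSubgroup_one
    (hk : k ∈ principalLevelSubgroup δ 1) :
    (k : GL (Fin g ⊕ Fin g) finAdeleQ) ∈
      ((integralFiniteAdeles ℚ).matrix.toSubmonoid.units : Subgroup (GL (Fin g ⊕ Fin g) finAdeleQ)) := by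
  rw [Literature.NumberTheory.Adeles.mem_units_matrix_integralFiniteAdeles_iff]
  refine ⟨fun i j => ?_, fun i j => ?_⟩
  · rw [← mem_integralAdeles_iff_mem_integralFiniteAdeles]
    exact isIntegral_of_isCongOne_one hk.1 i j
  · rw [← mem_integralAdeles_iff_mem_integralFiniteAdeles, ← Subgroup.coe_inv]
    exact isIntegral_of_isCongOne_one hk.2 i j

/-- **`Λ_{(k a⁻¹)⁻¹} = Λ_a` for `k ∈ K_δ(1)`** (`(k a⁻¹)⁻¹ = a k⁻¹` and ★ R60-19 `latticeOfGL_mul_eq_of_mem`: `Λ_{a u} = Λ_a` for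
`u ∈ GL_{2g}(ℤ̂)`). [cite: Milne2005ShimuraVarieties, §4 pp. 48–49] -/
theorem latticeOfGL_inv_coe_mul_inv_eq (hk : k ∈ principalLevelSubgroup δ 1) (a : gspFinAdelic δ) :
    latticeOfGL (((k * a⁻¹ : gspFinAdelic δ) : GL (Fin g ⊕ Fin g) finAdeleQ)⁻¹) =
      latticeOfGL (a : GL (Fin g ⊕ Fin g) finAdeleQ) := by
  rw [← Subgroup.coe_inv, _root_.mul_inv_rev, inv_inv, Subgroup.coe_mul]
  exact latticeOfGL_mul_eq_of_mem _
    (coe_mem_units_matrix_integralFiniteAdeles_of_mem_principalLevelSubgroup_one (inv_mem hk))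

/-- `Λ_{(a′⁻¹)⁻¹} = Λ_{a′}`. [cite: Milne2005ShimuraVarieties, §4 pp. 48–49] -/
theorem latticeOfGL_inv_coe_inv_eq (a' : gspFinAdelic δ) :
    latticeOfGL (((a'⁻¹ : gspFinAdelic δ) : GL (Fin g ⊕ Fin g) finAdeleQ)⁻¹) =
      latticeOfGL (a' : GL (Fin g ⊕ Fin g) finAdeleQ) := by
  rw [← Subgroup.coe_inv, inv_inv]

variable {v v₁ v₂ w w₁ w₂ : Fin g ⊕ Fin g → ℚ}

/-- **Partners vanish together**: for `k ∈ K_δ(1)` and `k a⁻¹ v̂ ≡ a′⁻¹ ŵ (mod ℤ̂^{2g})`, `v ∈ Λ_a ↔ w ∈ Λ_{a′}` (the general-`k`,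
two-sided form of the route-ξ′ `hker` bookkeeping). [cite: Milne2005ShimuraVarieties, §6 Thm. 6.11 p. 74 and p. 75] -/
theorem mem_latticeOfGL_iff_of_adelicCongr (hk : k ∈ principalLevelSubgroup δ 1)
    (h : AdelicCongr ((k * a⁻¹ : gspFinAdelic δ) : GL (Fin g ⊕ Fin g) finAdeleQ)
      ((a'⁻¹ : gspFinAdelic δ) : GL (Fin g ⊕ Fin g) finAdeleQ) v w) :
    v ∈ latticeOfGL (a : GL (Fin g ⊕ Fin g) finAdeleQ) ↔ w ∈ latticeOfGL (a' : GL (Fin g ⊕ Fin g) finAdeleQ) := by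
  rw [← latticeOfGL_inv_coe_mul_inv_eq hk a, ← latticeOfGL_inv_coe_inv_eq a']
  exact h.mem_latticeOfGL_iff

/-- **Level-`N` structures correspond exactly**: for `k ∈ K_δ(1)` and partners `v, w`, `N v ∈ Λ_a ↔ N w ∈ Λ_{a′}` — with ★
T1′ `SiegelAdelicMarking.mem_torsionPoints_iff_exists_r_eq` («`A(ℂ)[N] = u(N⁻¹Λ_a)`») the correspondence matches
`N`-torsion with `N`-torsion. [cite: Milne2005ShimuraVarieties, §6 Thm. 6.11 p. 74 and p. 75] [cite: Deligne1971TravauxShimura, 4.16 p. 150] -/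
theorem nsmul_mem_latticeOfGL_iff_of_adelicCongr (hk : k ∈ principalLevelSubgroup δ 1)
    (h : AdelicCongr ((k * a⁻¹ : gspFinAdelic δ) : GL (Fin g ⊕ Fin g) finAdeleQ)
      ((a'⁻¹ : gspFinAdelic δ) : GL (Fin g ⊕ Fin g) finAdeleQ) v w) (N : ℕ) :
    N • v ∈ latticeOfGL (a : GL (Fin g ⊕ Fin g) finAdeleQ) ↔ N • w ∈ latticeOfGL (a' : GL (Fin g ⊕ Fin g) finAdeleQ) := by
  rw [← latticeOfGL_inv_coe_mul_inv_eq hk a, ← latticeOfGL_inv_coe_inv_eq a']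
  exact h.nsmul_mem_latticeOfGL_iff N

/-- **Related pairs differ by lattice vectors simultaneously**: `v₁ − v₂ ∈ Λ_a ↔ w₁ − w₂ ∈ Λ_{a′}` for `k ∈ K_δ(1)`.
[cite: Milne2005ShimuraVarieties, §6 Thm. 6.11 p. 74 and p. 75] -/
theorem sub_mem_latticeOfGL_iff_of_adelicCongr (hk : k ∈ principalLevelSubgroup δ 1)
    (h₁ : AdelicCongr ((k * a⁻¹ : gspFinAdelic δ) : GL (Fin g ⊕ Fin g) finAdeleQ)
      ((a'⁻¹ : gspFinAdelic δ) : GL (Fin g ⊕ Fin g) finAdeleQ) v₁ w₁)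
    (h₂ : AdelicCongr ((k * a⁻¹ : gspFinAdelic δ) : GL (Fin g ⊕ Fin g) finAdeleQ)
      ((a'⁻¹ : gspFinAdelic δ) : GL (Fin g ⊕ Fin g) finAdeleQ) v₂ w₂) :
    v₁ - v₂ ∈ latticeOfGL (a : GL (Fin g ⊕ Fin g) finAdeleQ) ↔
      w₁ - w₂ ∈ latticeOfGL (a' : GL (Fin g ⊕ Fin g) finAdeleQ) :=
  mem_latticeOfGL_iff_of_adelicCongr hk (h₁.sub h₂)

/-- **THE CORRESPONDENCE DESCENDS TO A BIJECTION OF RATIONAL TORSION `u(V) → u′(V)`**: for markings `m` of `A` at `[J, a]`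
and `m′` of `A′` at `[J′, a′]`, `k ∈ K_δ(1)`, and two related pairs `(v₁, w₁)`, `(v₂, w₂)`:
`u(v₁) = u(v₂) ↔ u′(w₁) = u′(w₂)` (★ T1′ `r_eq_r_iff_sub_mem_latticeOfGL` on both sides) — well-definedness and injectivity
of `u(v) ↦ u′(w)`; surjectivity is `exists_r_partner_left`.  This is the adelic content of «`f` is an isomorphism of the
level structures `σ ∘ η_a K → η_{a′} K`» in ★ `SiegelRationalModel.IsModuli`.
[cite: Milne2005ShimuraVarieties, §6 Thm. 6.11 p. 74, §14 Prop. 14.12 p. 125] [cite: Deligne1971TravauxShimura, proof of Thm. 4.21 (a)–(c) p. 152] -/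
theorem SiegelAdelicMarking.r_eq_r_iff_of_adelicCongr (m : SiegelAdelicMarking J a A) (m' : SiegelAdelicMarking J' a' A')
    (hk : k ∈ principalLevelSubgroup δ 1)
    (h₁ : AdelicCongr ((k * a⁻¹ : gspFinAdelic δ) : GL (Fin g ⊕ Fin g) finAdeleQ)
      ((a'⁻¹ : gspFinAdelic δ) : GL (Fin g ⊕ Fin g) finAdeleQ) v₁ w₁)
    (h₂ : AdelicCongr ((k * a⁻¹ : gspFinAdelic δ) : GL (Fin g ⊕ Fin g) finAdeleQ)
      ((a'⁻¹ : gspFinAdelic δ) : GL (Fin g ⊕ Fin g) finAdeleQ) v₂ w₂) :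
    m.r v₁ = m.r v₂ ↔ m'.r w₁ = m'.r w₂ := by
  rw [m.r_eq_r_iff_sub_mem_latticeOfGL, m'.r_eq_r_iff_sub_mem_latticeOfGL]
  exact sub_mem_latticeOfGL_iff_of_adelicCongr hk h₁ h₂

/-- The case of one torsion point: `u(v) = 1 ↔ u′(w) = 1` for partners `v, w` (★ T1′ `r_eq_one_iff_mem_latticeOfGL`).
[cite: Milne2005ShimuraVarieties, §6 Thm. 6.11 p. 74] -/
theorem SiegelAdelicMarking.r_eq_one_iff_of_adelicCongr (m : SiegelAdelicMarking J a A) (m' : SiegelAdelicMarking J' a' A')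
    (hk : k ∈ principalLevelSubgroup δ 1)
    (h : AdelicCongr ((k * a⁻¹ : gspFinAdelic δ) : GL (Fin g ⊕ Fin g) finAdeleQ)
      ((a'⁻¹ : gspFinAdelic δ) : GL (Fin g ⊕ Fin g) finAdeleQ) v w) :
    m.r v = 1 ↔ m'.r w = 1 := by
  rw [m.r_eq_one_iff_mem_latticeOfGL, m'.r_eq_one_iff_mem_latticeOfGL]
  exact mem_latticeOfGL_iff_of_adelicCongr hk h

/-- **Surjectivity half**: every torsion point `u′(w)` of the target has a partner `u(v)` (`exists_adelicCongr_left`).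
[cite: Milne2005ShimuraVarieties, §6 Thm. 6.11 p. 74 and p. 75] -/
theorem SiegelAdelicMarking.exists_r_partner_left (b : GL (Fin g ⊕ Fin g) finAdeleQ) (m' : SiegelAdelicMarking J' a' A')
    (w : Fin g ⊕ Fin g → ℚ) :
    ∃ v : Fin g ⊕ Fin g → ℚ, AdelicCongr b ((a'⁻¹ : gspFinAdelic δ) : GL (Fin g ⊕ Fin g) finAdeleQ) v w ∧
      ∀ w', AdelicCongr b ((a'⁻¹ : gspFinAdelic δ) : GL (Fin g ⊕ Fin g) finAdeleQ) v w' → m'.r w' = m'.r w := by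
  obtain ⟨v, hv⟩ := exists_adelicCongr_left b _ w
  refine ⟨v, hv, fun w' hw' => ?_⟩
  rw [m'.r_eq_r_iff_sub_mem_latticeOfGL, ← latticeOfGL_inv_coe_inv_eq a']
  exact hv.sub_mem_latticeOfGL_right hw'

/-- **Every `v` has a partner, and all its partners name ONE torsion point of the target** (`exists_adelicCongr_right` +
right uniqueness) — the map `u(v) ↦ u′(w)` is everywhere defined. [cite: Milne2005ShimuraVarieties, §6 Thm. 6.11 p. 74 and p. 75] -/
theorem SiegelAdelicMarking.exists_r_partner_right (b : GL (Fin g ⊕ Fin g) finAdeleQ) (m' : SiegelAdelicMarking J' a' A')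
    (v : Fin g ⊕ Fin g → ℚ) :
    ∃ w : Fin g ⊕ Fin g → ℚ, AdelicCongr b ((a'⁻¹ : gspFinAdelic δ) : GL (Fin g ⊕ Fin g) finAdeleQ) v w ∧
      ∀ w', AdelicCongr b ((a'⁻¹ : gspFinAdelic δ) : GL (Fin g ⊕ Fin g) finAdeleQ) v w' → m'.r w' = m'.r w := by
  obtain ⟨w, hw⟩ := exists_adelicCongr_right b _ v
  refine ⟨w, hw, fun w' hw' => ?_⟩
  rw [m'.r_eq_r_iff_sub_mem_latticeOfGL, ← latticeOfGL_inv_coe_inv_eq a']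
  exact hw.sub_mem_latticeOfGL_right hw'

end GSp

end Literature.AlgebraicGeometry.ModuliOfAbelianVarieties

end
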